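import Summits.CriticalPhenomena.CardyFormulaZ2.Theses.CardyQContinuation

/-!
# `FirstJetAtOneBounded` from `UniformZeroFree` (route CardyQContinuation, Cauchy's estimate)

Item stmt-CriticalPhenomena-7102 (`FirstJetAtOneBounded`, support) asks that for every conformal
rectangle `R` the first `s`-derivative at `s = 1` of the self-dual random-cluster crossing ratio
`P_δ = N_δ / Z_δ` (jointly wired arcs; at `s = 1` this is the Bernoulli-`1/2` covariance
`Cov(1_C, |ω| + 2 k_B)`) stays bounded as `δ → 0⁺`.  Its docstring records that it is a NECESSARY
condition of the crux `UniformZeroFree` (stmt-CriticalPhenomena-5559): on the disc `|s - 1| < ρ`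
the crossing ratio is holomorphic and bounded by `M`, so Cauchy's estimate bounds `‖P′_δ(1)‖`.
This file proves exactly that implication:

* `norm_deriv_le_of_forall_mem_ball` — Cauchy's estimate on the half-radius circle;
* `differentiable_finsum_mem` — a `finsum` over a finite index set of entire functions is entire;
* `finite_powerset_edgeSet` — for `δ > 0` the configurations `ω ⊆ E(Ω_δ)` form a finite set, so
  `N_δ` and `Z_δ` are polynomials in `s`;
* `firstJetAtOneBounded_of_uniformZeroFree : UniformZeroFree → FirstJetAtOneBounded`, with the
  explicit constant `M / (ρ / 2)`.

The unconditional statement (boundedness of `Cov(1_C, |ω| + 2k_B)` for critical bond percolation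
on `ℤ²`, the "D-odd four-arm rate" of the item's card) is not touched here.
-/

namespace Summit.CriticalPhenomena.CardyFormulaZ2.Theorems.CardyQContinuation

open Filter Metric Set
open scoped Topology
open Literature.Probability.LatticeModels Literature.Probability.Percolation
open Literature.Probability.RandomPlanarGeometry
open Summit.CriticalPhenomena.CardyFormulaZ2.Theses.CardyQContinuation

noncomputable section

/-- **Cauchy's estimate, ball form.** If `P : ℂ → ℂ` is complex differentiable at every point of
the open disc `ball c ρ` and bounded there by `M`, then `‖P′(c)‖ ≤ M / (ρ/2)` (Cauchy's estimate
`Complex.norm_deriv_le_of_forall_mem_sphere_norm_le` on the circle of radius `ρ/2`). [folklore] -/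
theorem norm_deriv_le_of_forall_mem_ball {P : ℂ → ℂ} {c : ℂ} {ρ M : ℝ} (hρ : 0 < ρ)
    (hd : ∀ s ∈ ball c ρ, DifferentiableAt ℂ P s) (hb : ∀ s ∈ ball c ρ, ‖P s‖ ≤ M) :
    ‖deriv P c‖ ≤ M / (ρ / 2) := by
  have hρ2 : 0 < ρ / 2 := by positivity
  have hsub : closedBall c (ρ / 2) ⊆ ball c ρ := closedBall_subset_ball (by linarith)
  have hdiff : DifferentiableOn ℂ P (ball c ρ) := fun s hs => (hd s hs).differentiableWithinAt
  refine Complex.norm_deriv_le_of_forall_mem_sphere_norm_le hρ2 (hdiff.diffContOnCl_ball hsub) ?_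
  intro z hz
  exact hb z (hsub (sphere_subset_closedBall hz))

/-- A `finsum` over a finite index set of entire functions `s ↦ g s a` is entire (it is a
`Finset.sum`). [folklore] -/
theorem differentiable_finsum_mem {α : Type*} {S : Set α} (hS : S.Finite) {g : ℂ → α → ℂ}
    (hg : ∀ a, Differentiable ℂ (fun s => g s a)) :
    Differentiable ℂ (fun s => ∑ᶠ a ∈ S, g s a) := by
  have h : (fun s => ∑ᶠ a ∈ S, g s a) = fun s => ∑ a ∈ hS.toFinset, g s a := by
    funext s
    exact finsum_mem_eq_finite_toFinset_sum (fun a => g s a) hS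
  rw [h]
  exact Differentiable.fun_sum fun a _ => hg a

/-- For a bounded domain and positive mesh the discrete domain `Ω_δ` has finitely many edges (each
joins two sites of the finite set `meshDomain Ω δ`, `meshDomain_finite`), hence finitely many
bond configurations `ω ⊆ E(Ω_δ)`. [folklore] -/
-- the edge-finiteness step is adapted from `finite_edgeSet_discreteDomainGraph` of
-- Literature/Probability/Percolation/FourArmGarbanOrthogonality.lean (not imported: heavy cone)
theorem finite_powerset_edgeSet {Ω : Set ℂ} {δ : ℝ} (hΩ : Bornology.IsBounded Ω) (hδ : 0 < δ) :
    (𝒫 (discreteDomainGraph Ω δ).edgeSet).Finite := by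
  have hfin := meshDomain_finite hΩ hδ
  refine Set.Finite.powerset ?_
  refine ((hfin.prod hfin).image fun p : Site 2 × Site 2 => s(p.1, p.2)).subset ?_
  intro e he
  induction e using Sym2.ind with
  | h x y =>
    obtain ⟨-, hx, hy⟩ := discreteDomainGraph_adj_iff.1 ((SimpleGraph.mem_edgeSet _).1 he)
    exact ⟨(x, y), ⟨hx, hy⟩, rfl⟩

/-- An indicator-weighted monomial `s ↦ 𝟙_C(ω) · s ^ m` is entire. [folklore] -/
theorem differentiable_indicator_pow {α : Type*} (C : Set α) (m : α → ℕ) (a : α) :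
    Differentiable ℂ (fun s : ℂ => C.indicator (fun b => s ^ m b) a) := by
  by_cases ha : a ∈ C
  · simp only [Set.indicator_of_mem ha]
    exact differentiable_pow (m a)
  · simp only [Set.indicator_of_notMem ha]
    exact differentiable_const 0

/-- **`UniformZeroFree → FirstJetAtOneBounded`** (the "necessary condition" remark of item
stmt-CriticalPhenomena-7102, made a theorem). If for the conformal rectangle `R` the self-dual arc
partition function `Z_δ` has no zero and `‖N_δ/Z_δ‖ ≤ M` on the complex `ρ`-neighbourhood of
`[1, √2]` for all small `δ`, then, since that neighbourhood contains the disc `|s - 1| < ρ` on which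
`P_δ = N_δ/Z_δ` is a quotient of polynomials with non-vanishing denominator, Cauchy's estimate on
the circle `|s - 1| = ρ/2` gives `‖P′_δ(1)‖ ≤ M/(ρ/2)` for the same `δ`. [folklore] -/
theorem firstJetAtOneBounded_of_uniformZeroFree (hU : UniformZeroFree) : FirstJetAtOneBounded := by
  have hU' := hU
  dsimp only [UniformZeroFree] at hU'
  dsimp only [FirstJetAtOneBounded]
  intro R
  obtain ⟨ρ, hρ, M, hev⟩ := hU' R
  refine ⟨M / (ρ / 2), ?_⟩
  have hpos : ∀ᶠ δ in 𝓝[>] (0 : ℝ), 0 < δ := self_mem_nhdsWithin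
  filter_upwards [hev, hpos] with δ hδ hδpos
  -- the disc `|s - 1| < ρ` lies in the thickened segment
  have hball : ∀ s ∈ ball (1 : ℂ) ρ,
      s ∈ Metric.thickening ρ (((↑) : ℝ → ℂ) '' Set.Icc (1 : ℝ) (Real.sqrt 2)) := by
    intro s hs
    rw [Metric.mem_thickening_iff]
    refine ⟨((1 : ℝ) : ℂ), ⟨1, ⟨le_rfl, Real.one_lt_sqrt_two.le⟩, rfl⟩, ?_⟩
    simpa using hs
  have hfin := finite_powerset_edgeSet R.isBounded hδpos
  refine norm_deriv_le_of_forall_mem_ball hρ (fun s hs => ?_) (fun s hs => (hδ s (hball s hs)).2)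
  refine DifferentiableAt.div ?_ ?_ (hδ s (hball s hs)).1
  · exact (differentiable_finsum_mem hfin fun ω => differentiable_indicator_pow _ _ ω) s
  · exact (differentiable_finsum_mem hfin fun ω => differentiable_pow _) s


/-! ## The first jet at `s = 1` is a Bernoulli(1/2) covariance

For `δ > 0` the configurations `ω ⊆ E(Ω_δ)` form a finite set `F`; `Z_δ(s) = Σ_F s^{L(ω)}` and
`N_δ(s) = Σ_F 𝟙_C(ω) s^{L(ω)}` with `L = |ω| + 2 k_B(ω)`, so the quotient rule at `s = 1` gives
`P′_δ(1) = (Σ_F 𝟙_C L · |F| − Σ_F 𝟙_C · Σ_F L) / |F|² = E[𝟙_C L] − E[𝟙_C] E[L]` for the uniform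
(= Bernoulli-`1/2` product) measure on `F` — the exponential-family identity behind
`Cov_{P_1/2}(1_C, |ω| + 2k_B)` in the item text (Grimmett 2006, Thm 3.12 at `q = 1`). -/

/-- At `s = 1` the monomial `s ↦ s ^ m` has derivative `m`. [folklore] -/
theorem hasDerivAt_pow_one (m : ℕ) : HasDerivAt (fun s : ℂ => s ^ m) (m : ℂ) 1 := by
  simpa using hasDerivAt_pow m (1 : ℂ)

/-- At `s = 1` the restricted monomial `s ↦ 𝟙_C(a) · s ^ (m a)` has derivative `𝟙_C(a) · m a`.
[folklore] -/
theorem hasDerivAt_indicator_pow_one {α : Type*} (C : Set α) (m : α → ℕ) (a : α) :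
    HasDerivAt (fun s : ℂ => C.indicator (fun b => s ^ m b) a)
      (C.indicator (fun b => (m b : ℂ)) a) 1 := by
  by_cases ha : a ∈ C
  · simp only [Set.indicator_of_mem ha]
    exact hasDerivAt_pow_one (m a)
  · simp only [Set.indicator_of_notMem ha]
    exact hasDerivAt_const 1 0

/-- **Quotient rule at `s = 1` for a ratio of restricted monomial sums.** For a finite nonempty
index set `F`, exponents `m : α → ℕ` and an event `C`,
`d/ds|_{s=1} (Σ_{a∈F} 𝟙_C(a) s^{m a}) / (Σ_{a∈F} s^{m a})
  = ((Σ_F 𝟙_C m) · |F| − (Σ_F 𝟙_C) · (Σ_F m)) / |F|²`,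
i.e. the covariance `E[𝟙_C m] − E[𝟙_C] E[m]` under the uniform measure on `F`. [folklore] -/
theorem hasDerivAt_ratio_one {α : Type*} (F : Finset α) (hF : F.Nonempty) (C : Set α)
    (m : α → ℕ) :
    HasDerivAt (fun s : ℂ => (∑ a ∈ F, C.indicator (fun b => s ^ m b) a) / (∑ a ∈ F, s ^ m a))
      (((∑ a ∈ F, C.indicator (fun b => (m b : ℂ)) a) * F.card
        - (∑ a ∈ F, C.indicator (fun _ => (1 : ℂ)) a) * (∑ a ∈ F, (m a : ℂ))) / (F.card : ℂ) ^ 2)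
      1 := by
  have hN : HasDerivAt (fun s : ℂ => ∑ a ∈ F, C.indicator (fun b => s ^ m b) a)
      (∑ a ∈ F, C.indicator (fun b => (m b : ℂ)) a) 1 :=
    HasDerivAt.fun_sum fun a _ => hasDerivAt_indicator_pow_one C m a
  have hZ : HasDerivAt (fun s : ℂ => ∑ a ∈ F, s ^ m a) (∑ a ∈ F, (m a : ℂ)) 1 :=
    HasDerivAt.fun_sum fun a _ => hasDerivAt_pow_one (m a)
  have hZ1 : (∑ a ∈ F, (1 : ℂ) ^ m a) = F.card := by simp
  have hN1 : (∑ a ∈ F, C.indicator (fun b => (1 : ℂ) ^ m b) a)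
      = ∑ a ∈ F, C.indicator (fun _ => (1 : ℂ)) a := by
    simp only [one_pow]
  have hne : (∑ a ∈ F, (1 : ℂ) ^ m a) ≠ 0 := by
    rw [hZ1]
    exact_mod_cast hF.card_pos.ne'
  have key := hN.fun_div hZ hne
  simp only [hZ1, hN1] at key
  exact key

/-- **`P′_δ(1)` is a Bernoulli(1/2) covariance** (route CardyQContinuation, items
stmt-CriticalPhenomena-7102/7113/7129). For a conformal rectangle `R` and `δ > 0`, the first
`s`-derivative at `s = 1` of the self-dual crossing ratio `P_δ = N_δ/Z_δ` (jointly wired arcs) equals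
`(Σ_ω 𝟙_C(ω) L(ω) · #𝒫E − Σ_ω 𝟙_C(ω) · Σ_ω L(ω)) / (#𝒫E)²`, sums over `ω ∈ 𝒫 E(Ω_δ)`,
`L(ω) = |ω| + 2 k_B(ω)`: the covariance `Cov(1_C, |ω| + 2k_B)` under the uniform measure on bond
configurations of `Ω_δ`, i.e. under `P_{1/2}`. [folklore] -/
theorem deriv_crossingRatio_one (R : ConformalRectangle) {δ : ℝ} (hδ : 0 < δ) :
    deriv (fun s : ℂ =>
      (∑ᶠ ω ∈ 𝒫 (discreteDomainGraph R.carrier δ).edgeSet,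
        (discreteCrossing R.carrier δ (R.arc 0) (R.arc 2)).indicator
          (fun ω => s ^ (ω.ncard + 2 * Nat.card ((openGraph ω ⊔ wired
            (discreteArc R.carrier δ (R.arc 0) ∪ discreteArc R.carrier δ (R.arc 2))).induce
            (meshDomain R.carrier δ)).ConnectedComponent)) ω) /
      (∑ᶠ ω ∈ 𝒫 (discreteDomainGraph R.carrier δ).edgeSet,
        s ^ (ω.ncard + 2 * Nat.card ((openGraph ω ⊔ wired
            (discreteArc R.carrier δ (R.arc 0) ∪ discreteArc R.carrier δ (R.arc 2))).induce
            (meshDomain R.carrier δ)).ConnectedComponent))) 1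
    = ((∑ᶠ ω ∈ 𝒫 (discreteDomainGraph R.carrier δ).edgeSet,
          (discreteCrossing R.carrier δ (R.arc 0) (R.arc 2)).indicator
            (fun ω => ((ω.ncard + 2 * Nat.card ((openGraph ω ⊔ wired
              (discreteArc R.carrier δ (R.arc 0) ∪ discreteArc R.carrier δ (R.arc 2))).induce
              (meshDomain R.carrier δ)).ConnectedComponent : ℕ) : ℂ)) ω)
          * ((𝒫 (discreteDomainGraph R.carrier δ).edgeSet).ncard : ℂ)
        - (∑ᶠ ω ∈ 𝒫 (discreteDomainGraph R.carrier δ).edgeSet,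
            (discreteCrossing R.carrier δ (R.arc 0) (R.arc 2)).indicator (fun _ => (1 : ℂ)) ω)
          * (∑ᶠ ω ∈ 𝒫 (discreteDomainGraph R.carrier δ).edgeSet,
              ((ω.ncard + 2 * Nat.card ((openGraph ω ⊔ wired
                (discreteArc R.carrier δ (R.arc 0) ∪ discreteArc R.carrier δ (R.arc 2))).induce
                (meshDomain R.carrier δ)).ConnectedComponent : ℕ) : ℂ))) /
      ((𝒫 (discreteDomainGraph R.carrier δ).edgeSet).ncard : ℂ) ^ 2 := by
  have hfin := finite_powerset_edgeSet R.isBounded hδ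
  set F := hfin.toFinset with hF_def
  have hF : F.Nonempty := ⟨∅, by simp [hF_def]⟩
  simp only [finsum_mem_eq_finite_toFinset_sum _ hfin, Set.ncard_eq_toFinset_card _ hfin]
  exact (hasDerivAt_ratio_one F hF _ _).deriv

/-- **Covariance form of `FirstJetAtOneBounded`.** The item is equivalent to: for every conformal
rectangle the Bernoulli-`1/2` covariance `Cov(1_C, |ω| + 2 k_B)` (written as the normalised
double sum of `deriv_crossingRatio_one`) stays bounded as `δ → 0⁺`. [folklore] -/
theorem firstJetAtOneBounded_iff_cov :
    FirstJetAtOneBounded ↔ ∀ R : ConformalRectangle, ∃ M : ℝ, ∀ᶠ δ in 𝓝[>] (0 : ℝ),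
      ‖((∑ᶠ ω ∈ 𝒫 (discreteDomainGraph R.carrier δ).edgeSet,
          (discreteCrossing R.carrier δ (R.arc 0) (R.arc 2)).indicator
            (fun ω => ((ω.ncard + 2 * Nat.card ((openGraph ω ⊔ wired
              (discreteArc R.carrier δ (R.arc 0) ∪ discreteArc R.carrier δ (R.arc 2))).induce
              (meshDomain R.carrier δ)).ConnectedComponent : ℕ) : ℂ)) ω)
          * ((𝒫 (discreteDomainGraph R.carrier δ).edgeSet).ncard : ℂ)
        - (∑ᶠ ω ∈ 𝒫 (discreteDomainGraph R.carrier δ).edgeSet,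
            (discreteCrossing R.carrier δ (R.arc 0) (R.arc 2)).indicator (fun _ => (1 : ℂ)) ω)
          * (∑ᶠ ω ∈ 𝒫 (discreteDomainGraph R.carrier δ).edgeSet,
              ((ω.ncard + 2 * Nat.card ((openGraph ω ⊔ wired
                (discreteArc R.carrier δ (R.arc 0) ∪ discreteArc R.carrier δ (R.arc 2))).induce
                (meshDomain R.carrier δ)).ConnectedComponent : ℕ) : ℂ))) /
      ((𝒫 (discreteDomainGraph R.carrier δ).edgeSet).ncard : ℂ) ^ 2‖ ≤ M := by
  have hpos : ∀ᶠ δ in 𝓝[>] (0 : ℝ), 0 < δ := self_mem_nhdsWithin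
  dsimp only [FirstJetAtOneBounded]
  refine forall_congr' fun R => exists_congr fun M => ?_
  constructor
  · intro h
    filter_upwards [h, hpos] with δ hδ hδpos
    rwa [deriv_crossingRatio_one R hδpos] at hδ
  · intro h
    filter_upwards [h, hpos] with δ hδ hδpos
    rwa [deriv_crossingRatio_one R hδpos]

end

end Summit.CriticalPhenomena.CardyFormulaZ2.Theorems.CardyQContinuation
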